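import Literature.MathematicalPhysics.QuantumLattice.MagneticHubbardTorusTwistBound
import Literature.MathematicalPhysics.QuantumLattice.PeierlsHoppingGaugeFunctionBound
import HarnessLib

/-!
# The thermal twist bound in a background orbital field: the free-energy cost of a handle twist on top of
# ANY lattice `U(1)` gauge field is paid by the field-dressed kinetic energy, at every temperature

Topic `Literature/MathematicalPhysics/QuantumLattice` (family `hubbard`). Everything here is PROVED
(two operator definitions, no named fact). The positive-temperature twin of `MagneticHubbardTorusTwistBound.lean`
(`magneticFluxStiffness_le_one`: Bloch's bound `E_A(θ) + E_A(−θ) ≤ 2E_A(0) + 2θ²` on SECTOR GROUND ENERGIES in an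
arbitrary background field `A`) and the background-field twin of `HubbardNNNHoppingFluxThermal.lean`
(`log_partitionFn_toBlock_hubbardTorusTT'Flux_ge`: the thermal f-sum bound at ZERO field, where time reversal gives
`Z(−θ) = Z(θ)`) and of the Paramekanti–Trivedi–Randeria class file `PeierlsHoppingGaugeFunctionBound.lean` (phases
`u` compared with the FIELD-FREE `H₀`). Requested by the Hubbard cuprate cell `pub/hubbard-tc` (MO-S3, KT back-end;
lead RULING R50, 2026-08-27): the `H`-axis «orbital» locator of the D-0099 phase map read a `T = 0` theorem at
`T_KT⁻ > 0`; this file supplies the missing thermal f-sum in the field (key K1t[A]), so that no `T = 0 → T_KT⁻`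
transfer is needed.

## Content

§1 (general class of Paramekanti–Trivedi–Randeria, PRB 57 (1998) 11639, §II: arbitrary finite site set `Λ`, real
symmetric hopping data `t`, ANY real occupation-diagonal interaction `Φ`), now with an ARBITRARY antisymmetric
background bond-phase field `A` (an orbital magnetic field of any flux pattern) and a further antisymmetric twist
`v`; `H(w) = bdgHopping (t e^{iw}) + diagonal Φ`:
* `bdgHopping_peierls_add_twist_add_sub_twist_add` — operator midpoint identity
  `T(A + v) + T(A − v) + Σ_{x,y,σ} 2t_{xy}(1 − cos v_{xy}) e^{iA_{xy}} c†_{xσ}c_{yσ} = 2 T(A)` (the bond currents cancel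
  between `±v`; with a background field `Z(A − v) ≠ Z(A + v)` in general, so the symmetrisation replaces the
  time-reversal step of the zero-field proofs);
* `log_partitionFn_toBlock_bdgHopping_peierls_add_twist_add_sub_twist_ge` — **the thermal f-sum bound in the field**,
  by the tree's Peierls–Bogoliubov inequality (`log_partitionFn_sub_le_log_partitionFn_add`) at `A ± v` on every
  coordinate sector `p` and every `β`:
  `2 log Z_β(H(A)|_p) + 2β Σ_{x,y,σ} t_{xy}(1 − cos v_{xy}) Re(e^{iA_{xy}} ⟨(c†_{xσ}c_{yσ})|_p⟩_{β,p,A}) ≤ log Z_β(H(A+v)|_p) + log Z_β(H(A−v)|_p)`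
  — the symmetrised free-energy cost of the twist is at most `Σ_b (1 − cos v_b) K_b^A(β,p)` with `K_b^A` the bond
  kinetic energy IN THE FIELD.
§2 (the Hubbard torus in a lattice `U(1)` gauge field, `magneticHubbardTorus L A 1 U` of `MagneticHubbardTorus.lean`,
extra flux `θ` through the `e₁`-handle spread uniformly, `A · uniformTwistConfig L θ`, exactly as in
`MagneticHubbardTorusTwistBound.lean`):
* `magneticKinOp L A` — the field-dressed `e₁`-kinetic operator `Σ_{x,σ} (A(x,e₁) c†_{x+e₁,σ}c_{x,σ} + h.c.)`, Hermitian,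
  `Re⟨φ, K^A φ⟩ = 2 Σ_{x,σ} Re(A(x,e₁) h_{x,σ}(φ))`;
* `re_star_dotProduct_magneticTwist_add_neg_mulVec` / `posSemidef_magneticMidpointDefect_and_neg` — the midpoint
  identity `H_{A·τ_θ} + H_{A·τ_{−θ}} = 2H_A + 2(1 − cos(θ/L)) K^A` as the vanishing of a Hermitian quadratic form
  (from `re_rayleigh_twist_add_twist_neg`, p525739), transported into any Gibbs state by positivity;
* `log_partitionFn_toBlock_magneticTwist_add_neg_ge` — **thermal f-sum bound in the field on the torus**: for every
  `L ≥ 1`, `A`, `U`, `β` and every coordinate sector `p`,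
  `2 log Z_p(A) − 2β(1 − cos(θ/L)) Re⟨K^A|_p⟩_{β,p,A} ≤ log Z_p(A·τ_θ) + log Z_p(A·τ_{−θ})`;
* `abs_re_gibbsState_magneticKinOp_le` — `|Re⟨K^A|_p⟩_{β,B}| ≤ 2L²` for `L ≥ 2` (each bond amplitude `≤ ½`,
  `abs_sum_re_coe_mul_hop_le_sq`; Loewner sandwich `−2L² ≤ K^A ≤ 2L²` by normalising vectors);
* `magneticTwistLogZ_add_neg_ge` — hence for `β ≥ 0`, `L ≥ 2`: `2 log Z_p(0) − 2βθ² ≤ log Z_p(θ) + log Z_p(−θ)`;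
* `magneticThermalFluxStiffness_le_one` — **every THERMAL flux-stiffness constant of the Hubbard torus in an orbital
  field is at most `1`** (tree units, `t = 1`, `k_B = 1`): if `β ρ θ² ≤ log Z_p(0) − log Z_p(θ)` for `|θ| ≤ θ₀`
  (`β, θ₀ > 0`) then `ρ ≤ 1` — for every `L ≥ 2`, every gauge field `A`, every `U`, every `β > 0` and every coordinate
  sector (in a sector of fixed `(N↑, N↓)` a uniform Zeeman term is a constant multiple of the identity on the block,
  so the same holds at every Zeeman field). This is the `T > 0` twin of `magneticFluxStiffness_le_one`.
With the Nelson–Kosterlitz reading of the cell (`k_BT_KT ≤ (π/2)·J`, `J = ρ/2` — a HYPOTHESIS of the cell's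
dictionary, NOT a theorem here) this is the orbital-field-robust, utterly non-sharp ceiling `k_B T_KT ≤ (π/4)·t` per
plane at every temperature, with no monotonicity / `T = 0 → T_KT⁻` transfer.

HONEST SCOPE: elementary convexity (Peierls–Bogoliubov) inequalities on finite-dimensional matrices; no number of
physical interest, nothing about superconductivity, no claim that a Kosterlitz–Thouless transition exists; the
thermodynamic limit is not taken (every `L` is covered).

## References
* A. Paramekanti, N. Trivedi, M. Randeria, PRB 57 (1998) 11639 (arXiv:cond-mat/9801053), §II, §IV
  "Generalization to finite temperatures", eqs. (heat), (trial-rho). [ParamekantiTrivediRanderia1998]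
* T. Hazra, N. Verma, M. Randeria, PRX 9 (2019) 031049, eq. (2) (`D_s(T) ≤ D̃(T)`). [HazraVermaRanderia2019]
* D. Bohm, Phys. Rev. 75 (1949) 502 (Bloch's theorem in a background field). [Bohm1949]
* H. Watanabe, J. Stat. Phys. 177 (2019) 717, §2.2.1, §4.1 (twist operator bookkeeping). [Watanabe2019]
* D. J. Scalapino, S. R. White, S. Zhang, PRB 47 (1993) 7995, §II (free-energy flux stiffness at `T > 0`).
  [ScalapinoWhiteZhang1993]
-/

noncomputable section

namespace Literature.MathematicalPhysics.QuantumLattice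

open Matrix Finset Literature.MathematicalPhysics.QuantumFieldTheory
open scoped ComplexConjugate ComplexOrder

/-! ## §1 The Paramekanti–Trivedi–Randeria class in a background bond-phase field -/

section General

variable {Λ : Type*} [LinearOrder Λ] [Fintype Λ]

/-- **The bond currents cancel between `A + v` and `A − v`** (operator midpoint identity around a background field):
`T(A + v) + T(A − v) + Σ_{x,y,σ} 2 t_{xy}(1 − cos v_{xy}) e^{iA_{xy}} c†_{xσ} c_{yσ} = 2 T(A)` for real hopping data `t`, a
background phase field `A` and a twist `v` (PTR98 §IV eq. (heat) at operator level, exact `1 − cos` form, here on top of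
an arbitrary field). [cite: ParamekantiTrivediRanderia1998, §IV eq. (heat)] -/
theorem bdgHopping_peierls_add_twist_add_sub_twist_add (t A v : Λ → Λ → ℝ) :
    bdgHopping (fun x y => (t x y : ℂ) * Complex.exp (((A x y + v x y : ℝ) : ℂ) * Complex.I)) +
        bdgHopping (fun x y => (t x y : ℂ) * Complex.exp (((A x y - v x y : ℝ) : ℂ) * Complex.I)) +
        bdgHopping (fun x y => ((2 * (t x y * (1 - Real.cos (v x y))) : ℝ) : ℂ) *
          Complex.exp ((A x y : ℂ) * Complex.I)) =
      (2 : ℂ) • bdgHopping fun x y => (t x y : ℂ) * Complex.exp ((A x y : ℂ) * Complex.I) := by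
  rw [← bdgHopping_add, ← bdgHopping_add, ← bdgHopping_smul]
  congr 1
  funext x y
  simp only [Pi.add_apply, Pi.smul_apply, smul_eq_mul]
  have h1 : Complex.exp (((A x y + v x y : ℝ) : ℂ) * Complex.I) =
      Complex.exp ((A x y : ℂ) * Complex.I) * (Complex.cos (v x y : ℂ) + Complex.sin (v x y : ℂ) * Complex.I) := by
    rw [Complex.ofReal_add, add_mul, Complex.exp_add, Complex.exp_mul_I (v x y : ℂ)]
  have h2 : Complex.exp (((A x y - v x y : ℝ) : ℂ) * Complex.I) =
      Complex.exp ((A x y : ℂ) * Complex.I) * (Complex.cos (v x y : ℂ) - Complex.sin (v x y : ℂ) * Complex.I) := by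
    rw [Complex.ofReal_sub,
      show ((A x y : ℂ) - (v x y : ℂ)) * Complex.I = (A x y : ℂ) * Complex.I + (-(v x y : ℂ)) * Complex.I by ring,
      Complex.exp_add, Complex.exp_mul_I (-(v x y : ℂ)), Complex.cos_neg, Complex.sin_neg]
    ring
  rw [h1, h2]
  push_cast
  ring

/-- `H(w) = T(t e^{iw}) + V̂` with the background field `w = A` is Hermitian (restated from
`isHermitian_bdgHopping_peierls_add_diagonal` for the shifted phases `A ± v`). [cite: ParamekantiTrivediRanderia1998, §II] -/
private theorem isHermitian_bdgHopping_peierls_shift_add_diagonal {t A v : Λ → Λ → ℝ} (ht : ∀ x y, t y x = t x y)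
    (hA : ∀ x y, A y x = -A x y) (hv : ∀ x y, v y x = -v x y) (Φ : Finset (Orb Λ) → ℝ) (ε : ℝ) :
    (bdgHopping (fun x y => (t x y : ℂ) * Complex.exp (((A x y + ε * v x y : ℝ) : ℂ) * Complex.I)) +
      diagonal fun s => (Φ s : ℂ)).IsHermitian :=
  isHermitian_bdgHopping_peierls_add_diagonal (u := fun x y => A x y + ε * v x y) ht
    (fun x y => by simp only [hA x y, hv x y]; ring) Φ

/-- The hopping part with COMPLEX weights in the Gibbs state of a block Hamiltonian `B` on a sector:
`⟨T(τ)|_p⟩ = Σ_{x,y,σ} τ_{xy} ⟨(c†_{xσ} c_{yσ})|_p⟩`. [folklore] -/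
private theorem gibbsState_toBlock_bdgHopping (τ : Λ → Λ → ℂ) (β : ℝ)
    (p : Finset (Orb Λ) → Prop) [Fintype {a // p a}] [DecidableEq {a // p a}]
    (B : Matrix {a // p a} {a // p a} ℂ) :
    gibbsState β B ((bdgHopping τ).toBlock p p) =
      ∑ x : Λ, ∑ y : Λ, ∑ σ : Fin 2,
        τ x y * gibbsState β B ((creation (orb x σ) * annihilation (orb y σ)).toBlock p p) := by
  have h : (bdgHopping τ).toBlock p p =
      ∑ x : Λ, ∑ y : Λ, ∑ σ : Fin 2, τ x y • (creation (orb x σ) * annihilation (orb y σ)).toBlock p p := by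
    ext a b
    simp only [bdgHopping, toBlock_apply, Matrix.sum_apply, Matrix.smul_apply, smul_eq_mul]
  rw [h]
  simp only [map_sum, map_smul, smul_eq_mul]

/-- **Thermal f-sum bound on the symmetrised flux cost of the sector free energy, arbitrary background bond phases**
(Paramekanti–Trivedi–Randeria class: any finite site set, symmetric real hopping `t`, ANY real occupation-diagonal
interaction `Φ`; antisymmetric background field `A` and twist `v`; every `β` and every coordinate sector `p`;
`⟨·⟩_{β,p,A}` the Gibbs state of `H(A)|_p`):
`2 log Z_β(H(A)|_p) + 2β Σ_{x,y,σ} t_{xy}(1 − cos v_{xy}) Re(e^{iA_{xy}} ⟨(c†_{xσ} c_{yσ})|_p⟩_{β,p,A}) ≤ log Z_β(H(A+v)|_p) + log Z_β(H(A−v)|_p)`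
(Peierls–Bogoliubov at `A ± v` and the midpoint identity; with a background field `Z(A − v) ≠ Z(A + v)` in general, so no
time-reversal step). At `A = 0` and with time reversal this is `log_partitionFn_toBlock_bdgHopping_peierls_ge`.
[cite: ParamekantiTrivediRanderia1998, §IV eqs. (heat), (trial-rho)] -/
theorem log_partitionFn_toBlock_bdgHopping_peierls_add_twist_add_sub_twist_ge {t A v : Λ → Λ → ℝ}
    (ht : ∀ x y, t y x = t x y) (hA : ∀ x y, A y x = -A x y) (hv : ∀ x y, v y x = -v x y)
    (Φ : Finset (Orb Λ) → ℝ) (β : ℝ) (p : Finset (Orb Λ) → Prop) [Fintype {a // p a}] [DecidableEq {a // p a}] :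
    2 * Real.log (partitionFn β ((bdgHopping (fun x y => (t x y : ℂ) * Complex.exp ((A x y : ℂ) * Complex.I)) +
        diagonal fun s => (Φ s : ℂ)).toBlock p p)).re +
      2 * β * ∑ x : Λ, ∑ y : Λ, ∑ σ : Fin 2, t x y * (1 - Real.cos (v x y)) *
        (Complex.exp ((A x y : ℂ) * Complex.I) *
          gibbsState β ((bdgHopping (fun x y => (t x y : ℂ) * Complex.exp ((A x y : ℂ) * Complex.I)) +
            diagonal fun s => (Φ s : ℂ)).toBlock p p)
            ((creation (orb x σ) * annihilation (orb y σ)).toBlock p p)).re ≤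
      Real.log (partitionFn β ((bdgHopping (fun x y => (t x y : ℂ) *
          Complex.exp (((A x y + v x y : ℝ) : ℂ) * Complex.I)) + diagonal fun s => (Φ s : ℂ)).toBlock p p)).re +
        Real.log (partitionFn β ((bdgHopping (fun x y => (t x y : ℂ) *
          Complex.exp (((A x y - v x y : ℝ) : ℂ) * Complex.I)) + diagonal fun s => (Φ s : ℂ)).toBlock p p)).re := by
  rcases isEmpty_or_nonempty {a // p a} with hp | hp
  · simp [partitionFn, Matrix.trace, gibbsState_apply]
  set H₀ := (bdgHopping fun x y => (t x y : ℂ) * Complex.exp ((A x y : ℂ) * Complex.I)) +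
    diagonal fun s => (Φ s : ℂ) with hH₀def
  set Hp := bdgHopping (fun x y => (t x y : ℂ) * Complex.exp (((A x y + v x y : ℝ) : ℂ) * Complex.I)) +
    diagonal fun s => (Φ s : ℂ) with hHpdef
  set Hm := bdgHopping (fun x y => (t x y : ℂ) * Complex.exp (((A x y - v x y : ℝ) : ℂ) * Complex.I)) +
    diagonal fun s => (Φ s : ℂ) with hHmdef
  have hH₀ : H₀.IsHermitian := isHermitian_bdgHopping_peierls_add_diagonal ht hA Φ
  have hHp : Hp.IsHermitian := by
    have h := isHermitian_bdgHopping_peierls_shift_add_diagonal ht hA hv Φ 1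
    simp only [one_mul] at h
    exact h
  have hHm : Hm.IsHermitian := by
    have h := isHermitian_bdgHopping_peierls_shift_add_diagonal ht hA hv Φ (-1)
    simp only [neg_mul, one_mul, ← sub_eq_add_neg] at h
    exact h
  set B₀ := H₀.toBlock p p with hB₀def
  have hB₀ : B₀.IsHermitian := hH₀.submatrix _
  have hWp : (Hp.toBlock p p - B₀).IsHermitian := (hHp.submatrix _).sub hB₀
  have hWm : (Hm.toBlock p p - B₀).IsHermitian := (hHm.submatrix _).sub hB₀
  -- Peierls–Bogoliubov at the block `H(A)|_p`, for `A + v` and `A - v`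
  have hPB1 := log_partitionFn_sub_le_log_partitionFn_add hB₀ hWp β
  have hPB2 := log_partitionFn_sub_le_log_partitionFn_add hB₀ hWm β
  rw [add_sub_cancel] at hPB1 hPB2
  -- the midpoint identity, compressed to the sector and evaluated in the Gibbs state
  have hmid := bdgHopping_peierls_add_twist_add_sub_twist_add t A v
  have hblock : Hp.toBlock p p - B₀ + (Hm.toBlock p p - B₀) =
      -(bdgHopping (fun x y => ((2 * (t x y * (1 - Real.cos (v x y))) : ℝ) : ℂ) *
        Complex.exp ((A x y : ℂ) * Complex.I))).toBlock p p := by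
    ext a b
    have hab := congrFun (congrFun hmid a) b
    simp only [Matrix.add_apply, Matrix.smul_apply, smul_eq_mul] at hab
    simp only [hHpdef, hHmdef, hB₀def, hH₀def, toBlock_apply, Matrix.add_apply, Matrix.sub_apply,
      Matrix.neg_apply]
    linear_combination hab
  have hsum : (gibbsState β B₀ (Hp.toBlock p p - B₀)).re + (gibbsState β B₀ (Hm.toBlock p p - B₀)).re =
      -(2 * ∑ x : Λ, ∑ y : Λ, ∑ σ : Fin 2, t x y * (1 - Real.cos (v x y)) *
        (Complex.exp ((A x y : ℂ) * Complex.I) *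
          gibbsState β B₀ ((creation (orb x σ) * annihilation (orb y σ)).toBlock p p)).re) := by
    rw [← Complex.add_re, ← map_add, hblock, map_neg, Complex.neg_re, gibbsState_toBlock_bdgHopping]
    simp only [Complex.re_sum, Finset.mul_sum, mul_assoc, Complex.re_ofReal_mul]
  have hkey := congrArg (fun z : ℝ => β * z) hsum
  simp only [mul_add] at hkey
  linarith

end General

/-! ## §2 The Hubbard torus in a lattice `U(1)` gauge field: thermal twist bound -/

section Torus

variable {L : ℕ} [NeZero L]

section Defs

variable (L)

/-- The **field-dressed `e₁`-kinetic operator** of the magnetic Hubbard torus: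
`K^A = Σ_{x,σ} (A(x,e₁) c†_{x+e₁,σ} c_{x,σ} + conj A(x,e₁) c†_{x,σ} c_{x+e₁,σ})` — the part of `−H_A(1,U)` carried by the
`e₁`-bonds (the operator that pays for an `e₁`-handle twist; Hazra–Verma–Randeria's `D̃` operator in the field).
[cite: HazraVermaRanderia2019, eq. (4)] -/
def magneticKinOp (A : GaugeConfig 2 L Circle) :
    Matrix (Finset (Orb (FermionTorus 2 L))) (Finset (Orb (FermionTorus 2 L))) ℂ :=
  ∑ x : Site 2 L, ∑ σ : Fin 2,
    ((((A (x, 0) : Circle) : ℂ)) •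
        (creation (orb (FermionTorus.ofTorusSite (Site.shift x 0)) σ) *
          annihilation (orb (FermionTorus.ofTorusSite x) σ)) +
      (starRingEnd ℂ) ((A (x, 0) : Circle) : ℂ) •
        (creation (orb (FermionTorus.ofTorusSite x) σ) *
          annihilation (orb (FermionTorus.ofTorusSite (Site.shift x 0)) σ)))

/-- **`log Z_p(θ)` of the handle-twisted magnetic torus on a coordinate sector**: the logarithm of (the real part of)
`Matrix.partitionFn β` of the compression to the sector `p` of `magneticHubbardTorus L (A · uniformTwistConfig L θ) 1 U`
(the field `A` with every `e₁`-edge phase multiplied by `e^{iθ/L}`); `−β⁻¹·magneticTwistLogZ` is the sector free energy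
`F_p(θ)`, whose (symmetrised) curvature in `θ` is the thermal flux stiffness of Scalapino–White–Zhang §II.
[cite: ScalapinoWhiteZhang1993, §II] -/
def magneticTwistLogZ (A : GaugeConfig 2 L Circle) (U β θ : ℝ) (p : Finset (Orb (FermionTorus 2 L)) → Prop)
    [Fintype {a // p a}] [DecidableEq {a // p a}] : ℝ :=
  Real.log (partitionFn β ((magneticHubbardTorus L (A * uniformTwistConfig L θ) 1 U).toBlock p p)).re

end Defs

/-- `K^A` is Hermitian (each summand is `a•X + conj a•Xᴴ`). [cite: HazraVermaRanderia2019, eq. (4)] -/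
theorem isHermitian_magneticKinOp (A : GaugeConfig 2 L Circle) : (magneticKinOp L A).IsHermitian := by
  unfold Matrix.IsHermitian magneticKinOp
  simp only [conjTranspose_sum, conjTranspose_add, conjTranspose_smul, conjTranspose_creation_mul_annihilation,
    Complex.star_def, Complex.conj_conj]
  exact Finset.sum_congr rfl fun x _ => Finset.sum_congr rfl fun σ _ => add_comm _ _

/-- `Re⟨φ, K^A φ⟩ = 2 Σ_{x,σ} Re(A(x,e₁)·h_{x,σ}(φ))`, `h_{x,σ}(φ) = ⟨φ, c†_{x+e₁,σ}c_{x,σ} φ⟩` (the reversed hop has the conjugate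
amplitude). [cite: HazraVermaRanderia2019, eq. (4)] -/
theorem re_star_dotProduct_magneticKinOp_mulVec (A : GaugeConfig 2 L Circle) (φ : Fock (Orb (FermionTorus 2 L))) :
    (star φ ⬝ᵥ (magneticKinOp L A *ᵥ φ)).re =
      2 * ∑ x : Site 2 L, ∑ σ : Fin 2,
        (((A (x, 0) : Circle) : ℂ) *
          (star φ ⬝ᵥ ((creation (orb (FermionTorus.ofTorusSite (Site.shift x 0)) σ) *
            annihilation (orb (FermionTorus.ofTorusSite x) σ)) *ᵥ φ))).re := by
  unfold magneticKinOp
  simp only [Matrix.sum_mulVec, add_mulVec, smul_mulVec, dotProduct_sum, dotProduct_add, dotProduct_smul,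
    smul_eq_mul, Complex.re_sum, Complex.add_re, Finset.mul_sum]
  refine Finset.sum_congr rfl fun x _ => Finset.sum_congr rfl fun σ _ => ?_
  rw [star_dotProduct_creation_mul_annihilation_mulVec_swap
      (orb (FermionTorus.ofTorusSite (Site.shift x 0)) σ) (orb (FermionTorus.ofTorusSite x) σ),
    ← map_mul, Complex.conj_re, two_mul]

/-- **The midpoint identity in a fixed vector, background field**: `Re⟨φ, (H_{A·τ_θ} + H_{A·τ_{−θ}}) φ⟩ =
2 Re⟨φ, H_A φ⟩ + 2(1 − cos(θ/L)) Re⟨φ, K^A φ⟩` (`t = 1`; `re_rayleigh_twist_add_twist_neg` of the `T = 0` file: the two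
current terms cancel, only the field-dressed kinetic weights survive). [cite: Watanabe2019, §2.2.3 and §4.1] -/
theorem re_star_dotProduct_magneticTwist_add_neg_mulVec (A : GaugeConfig 2 L Circle) (U θ : ℝ)
    (φ : Fock (Orb (FermionTorus 2 L))) :
    (star φ ⬝ᵥ ((magneticHubbardTorus L (A * uniformTwistConfig L θ) 1 U +
        magneticHubbardTorus L (A * uniformTwistConfig L (-θ)) 1 U) *ᵥ φ)).re =
      2 * (star φ ⬝ᵥ (magneticHubbardTorus L A 1 U *ᵥ φ)).re +
        2 * (1 - Real.cos (θ / L)) * (star φ ⬝ᵥ (magneticKinOp L A *ᵥ φ)).re := by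
  rw [add_mulVec, dotProduct_add, Complex.add_re, re_rayleigh_twist_add_twist_neg A U θ φ,
    re_star_dotProduct_magneticKinOp_mulVec]
  ring

/-- The **midpoint defect** `H_{A·τ_θ} + H_{A·τ_{−θ}} − 2H_A − 2(1 − cos(θ/L)) K^A` and its negative are both positive
semidefinite (its real quadratic form vanishes by the midpoint identity, its imaginary one because it is Hermitian).
[cite: Watanabe2019, §2.2.3 and §4.1] -/
theorem posSemidef_magneticMidpointDefect_and_neg (A : GaugeConfig 2 L Circle) (U θ : ℝ) :
    (magneticHubbardTorus L (A * uniformTwistConfig L θ) 1 U + magneticHubbardTorus L (A * uniformTwistConfig L (-θ)) 1 U -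
        ((2 : ℝ) : ℂ) • magneticHubbardTorus L A 1 U -
          ((2 * (1 - Real.cos (θ / L)) : ℝ) : ℂ) • magneticKinOp L A).PosSemidef ∧
      (-(magneticHubbardTorus L (A * uniformTwistConfig L θ) 1 U +
          magneticHubbardTorus L (A * uniformTwistConfig L (-θ)) 1 U -
        ((2 : ℝ) : ℂ) • magneticHubbardTorus L A 1 U -
          ((2 * (1 - Real.cos (θ / L)) : ℝ) : ℂ) • magneticKinOp L A)).PosSemidef := by
  have hD : (magneticHubbardTorus L (A * uniformTwistConfig L θ) 1 U +
      magneticHubbardTorus L (A * uniformTwistConfig L (-θ)) 1 U -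
        ((2 : ℝ) : ℂ) • magneticHubbardTorus L A 1 U -
          ((2 * (1 - Real.cos (θ / L)) : ℝ) : ℂ) • magneticKinOp L A).IsHermitian :=
    (((magneticHubbardTorus_isHermitian _ 1 U).add (magneticHubbardTorus_isHermitian _ 1 U)).sub
      (isHermitian_ofReal_smul (magneticHubbardTorus_isHermitian A 1 U) _)).sub
      (isHermitian_ofReal_smul (isHermitian_magneticKinOp A) _)
  have h0 : ∀ φ : Fock (Orb (FermionTorus 2 L)),
      star φ ⬝ᵥ ((magneticHubbardTorus L (A * uniformTwistConfig L θ) 1 U +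
        magneticHubbardTorus L (A * uniformTwistConfig L (-θ)) 1 U -
          ((2 : ℝ) : ℂ) • magneticHubbardTorus L A 1 U -
            ((2 * (1 - Real.cos (θ / L)) : ℝ) : ℂ) • magneticKinOp L A) *ᵥ φ) = 0 := by
    intro φ
    have hre : (star φ ⬝ᵥ ((magneticHubbardTorus L (A * uniformTwistConfig L θ) 1 U +
        magneticHubbardTorus L (A * uniformTwistConfig L (-θ)) 1 U -
          ((2 : ℝ) : ℂ) • magneticHubbardTorus L A 1 U -
            ((2 * (1 - Real.cos (θ / L)) : ℝ) : ℂ) • magneticKinOp L A) *ᵥ φ)).re = 0 := by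
      rw [sub_mulVec, sub_mulVec, dotProduct_sub, dotProduct_sub, Complex.sub_re, Complex.sub_re,
        smul_mulVec, smul_mulVec, dotProduct_smul, dotProduct_smul, smul_eq_mul, smul_eq_mul,
        Complex.re_ofReal_mul, Complex.re_ofReal_mul, re_star_dotProduct_magneticTwist_add_neg_mulVec]
      ring
    have him : (star φ ⬝ᵥ ((magneticHubbardTorus L (A * uniformTwistConfig L θ) 1 U +
        magneticHubbardTorus L (A * uniformTwistConfig L (-θ)) 1 U -
          ((2 : ℝ) : ℂ) • magneticHubbardTorus L A 1 U -
            ((2 * (1 - Real.cos (θ / L)) : ℝ) : ℂ) • magneticKinOp L A) *ᵥ φ)).im = 0 := by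
      have h := hD.im_star_dotProduct_mulVec_self φ
      simpa using h
    exact Complex.ext (by simpa using hre) (by simpa using him)
  refine ⟨PosSemidef.of_dotProduct_mulVec_nonneg hD fun φ => by rw [h0 φ],
    PosSemidef.of_dotProduct_mulVec_nonneg hD.neg fun φ => ?_⟩
  rw [neg_mulVec, dotProduct_neg, h0 φ, neg_zero]

/-- **The midpoint identity in the Gibbs state of a sector**: for the Gibbs state of ANY Hermitian block Hamiltonian
`B` on the sector `p`,
`Re⟨(H_{A·τ_θ})|_p − H_A|_p⟩ + Re⟨(H_{A·τ_{−θ}})|_p − H_A|_p⟩ = 2(1 − cos(θ/L)) Re⟨K^A|_p⟩` (positivity of the Gibbs state on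
`±` the midpoint defect). [cite: Watanabe2019, §2.2.3 and §4.1] -/
theorem re_gibbsState_magneticTwist_add_twist_neg (A : GaugeConfig 2 L Circle) (U θ β : ℝ)
    (p : Finset (Orb (FermionTorus 2 L)) → Prop) [Fintype {a // p a}] [DecidableEq {a // p a}]
    {B : Matrix {a // p a} {a // p a} ℂ} (hB : B.IsHermitian) :
    (gibbsState β B ((magneticHubbardTorus L (A * uniformTwistConfig L θ) 1 U).toBlock p p -
          (magneticHubbardTorus L A 1 U).toBlock p p)).re +
        (gibbsState β B ((magneticHubbardTorus L (A * uniformTwistConfig L (-θ)) 1 U).toBlock p p -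
          (magneticHubbardTorus L A 1 U).toBlock p p)).re =
      2 * (1 - Real.cos (θ / L)) * (gibbsState β B ((magneticKinOp L A).toBlock p p)).re := by
  obtain ⟨hpos, hneg⟩ := posSemidef_magneticMidpointDefect_and_neg A U θ
  set D := magneticHubbardTorus L (A * uniformTwistConfig L θ) 1 U +
      magneticHubbardTorus L (A * uniformTwistConfig L (-θ)) 1 U -
    ((2 : ℝ) : ℂ) • magneticHubbardTorus L A 1 U - ((2 * (1 - Real.cos (θ / L)) : ℝ) : ℂ) • magneticKinOp L A
    with hDdef
  have h1 : 0 ≤ gibbsState β B (D.toBlock p p) :=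
    gibbsState_nonneg_of_posSemidef β hB (hpos.submatrix Subtype.val)
  have h2 : 0 ≤ gibbsState β B ((-D).toBlock p p) :=
    gibbsState_nonneg_of_posSemidef β hB (hneg.submatrix Subtype.val)
  have hnegblock : (-D).toBlock p p = -D.toBlock p p := rfl
  rw [hnegblock, map_neg, neg_nonneg] at h2
  have hzero : gibbsState β B (D.toBlock p p) = 0 := le_antisymm h2 h1
  have hsplit : (magneticHubbardTorus L (A * uniformTwistConfig L θ) 1 U).toBlock p p -
        (magneticHubbardTorus L A 1 U).toBlock p p +
      ((magneticHubbardTorus L (A * uniformTwistConfig L (-θ)) 1 U).toBlock p p -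
        (magneticHubbardTorus L A 1 U).toBlock p p) =
      D.toBlock p p + ((2 * (1 - Real.cos (θ / L)) : ℝ) : ℂ) • (magneticKinOp L A).toBlock p p := by
    ext a b
    simp only [hDdef, toBlock_apply, Matrix.add_apply, Matrix.sub_apply, Matrix.smul_apply, smul_eq_mul]
    push_cast
    ring
  rw [← Complex.add_re, ← map_add, hsplit, map_add, hzero, zero_add, map_smul, smul_eq_mul,
    Complex.re_ofReal_mul]

/-- **Thermal f-sum bound on the flux cost of the sector free energy, background field** (every `L ≥ 1`, every gauge
field `A`, every `U`, `β` and every coordinate sector `p`; `⟨·⟩_{β,p,A}` the Gibbs state of the untwisted block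
`H_A|_p`): `2 log Z_β(H_A|_p) − 2β(1 − cos(θ/L)) Re⟨K^A⟩_{β,p,A} ≤ log Z_β(H_{A·τ_θ}|_p) + log Z_β(H_{A·τ_{−θ}}|_p)`, i.e.
for `β > 0` the sector free energies obey `F_p(θ) + F_p(−θ) − 2F_p(0) ≤ 2(1 − cos(θ/L)) Re⟨K^A⟩_{β,p,A} ≤ (θ/L)² Re⟨K^A⟩`
(when the latter is `≥ 0`) — Paramekanti–Trivedi–Randeria's finite-temperature kinetic bound (§IV) in an arbitrary
orbital field, from Peierls–Bogoliubov at `±θ` and the midpoint identity (no time-reversal step is available in a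
field, hence the symmetrisation). [cite: ParamekantiTrivediRanderia1998, eq. (3) and §IV] -/
theorem log_partitionFn_toBlock_magneticTwist_add_neg_ge (A : GaugeConfig 2 L Circle) (U θ β : ℝ)
    (p : Finset (Orb (FermionTorus 2 L)) → Prop) [Fintype {a // p a}] [DecidableEq {a // p a}] :
    2 * Real.log (partitionFn β ((magneticHubbardTorus L A 1 U).toBlock p p)).re -
        2 * β * (1 - Real.cos (θ / L)) *
          (gibbsState β ((magneticHubbardTorus L A 1 U).toBlock p p) ((magneticKinOp L A).toBlock p p)).re ≤
      Real.log (partitionFn β ((magneticHubbardTorus L (A * uniformTwistConfig L θ) 1 U).toBlock p p)).re +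
        Real.log (partitionFn β ((magneticHubbardTorus L (A * uniformTwistConfig L (-θ)) 1 U).toBlock p p)).re := by
  rcases isEmpty_or_nonempty {a // p a} with hp | hp
  · simp [partitionFn, Matrix.trace, gibbsState_apply]
  set B := (magneticHubbardTorus L A 1 U).toBlock p p with hBdef
  have hB : B.IsHermitian := (magneticHubbardTorus_isHermitian A 1 U).submatrix _
  have hWp : ((magneticHubbardTorus L (A * uniformTwistConfig L θ) 1 U).toBlock p p - B).IsHermitian :=
    ((magneticHubbardTorus_isHermitian _ 1 U).submatrix _).sub hB
  have hWm : ((magneticHubbardTorus L (A * uniformTwistConfig L (-θ)) 1 U).toBlock p p - B).IsHermitian :=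
    ((magneticHubbardTorus_isHermitian _ 1 U).submatrix _).sub hB
  -- Peierls–Bogoliubov at the untwisted block, for `+θ` and `-θ`
  have hPB1 := log_partitionFn_sub_le_log_partitionFn_add hB hWp β
  have hPB2 := log_partitionFn_sub_le_log_partitionFn_add hB hWm β
  rw [add_sub_cancel] at hPB1 hPB2
  -- the two first-order terms add up to the field-dressed kinetic term
  have hsum := re_gibbsState_magneticTwist_add_twist_neg A U θ β p hB
  rw [← hBdef] at hsum
  have hkey : β * (gibbsState β B ((magneticHubbardTorus L (A * uniformTwistConfig L θ) 1 U).toBlock p p - B)).re +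
      β * (gibbsState β B ((magneticHubbardTorus L (A * uniformTwistConfig L (-θ)) 1 U).toBlock p p - B)).re =
        β * (2 * (1 - Real.cos (θ / L)) * (gibbsState β B ((magneticKinOp L A).toBlock p p)).re) := by
    rw [← mul_add, hsum]
  linarith

/-- For `L ≥ 2` the field-dressed `e₁`-kinetic quadratic form of a unit vector is at most `2L²` in modulus (each bond
amplitude `≤ ½`; `abs_sum_re_coe_mul_hop_le_sq` of the `T = 0` file). [cite: Watanabe2019, §4.1] -/
theorem abs_re_star_dotProduct_magneticKinOp_mulVec_le (hL : 2 ≤ L) (A : GaugeConfig 2 L Circle)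
    {φ : Fock (Orb (FermionTorus 2 L))} (hφ : star φ ⬝ᵥ φ = 1) :
    |(star φ ⬝ᵥ (magneticKinOp L A *ᵥ φ)).re| ≤ 2 * (L : ℝ) ^ 2 := by
  rw [re_star_dotProduct_magneticKinOp_mulVec, abs_mul, abs_two]
  exact mul_le_mul_of_nonneg_left (abs_sum_re_coe_mul_hop_le_sq hL hφ A) zero_le_two

/-- **Loewner sandwich `−2L² ≤ K^A ≤ 2L²`** (`L ≥ 2`): for every real `s` with `|s| ≤ 1`, `2L²·1 + s·K^A` is positive
semidefinite (normalise a nonzero vector and use the unit-vector bound). [cite: Watanabe2019, §4.1] -/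
theorem posSemidef_smul_one_add_smul_magneticKinOp (hL : 2 ≤ L) (A : GaugeConfig 2 L Circle) {s : ℝ}
    (hs : |s| ≤ 1) :
    (((2 * (L : ℝ) ^ 2 : ℝ) : ℂ) • (1 : Matrix (Finset (Orb (FermionTorus 2 L))) (Finset (Orb (FermionTorus 2 L))) ℂ) +
      ((s : ℝ) : ℂ) • magneticKinOp L A).PosSemidef := by
  have hH : ((((2 * (L : ℝ) ^ 2 : ℝ) : ℂ) •
        (1 : Matrix (Finset (Orb (FermionTorus 2 L))) (Finset (Orb (FermionTorus 2 L))) ℂ) +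
      ((s : ℝ) : ℂ) • magneticKinOp L A)).IsHermitian :=
    (isHermitian_ofReal_smul isHermitian_one _).add (isHermitian_ofReal_smul (isHermitian_magneticKinOp A) _)
  refine PosSemidef.of_dotProduct_mulVec_nonneg hH fun x => ?_
  have him := hH.im_star_dotProduct_mulVec_self x
  rw [Complex.nonneg_iff]
  refine ⟨?_, by simpa using him.symm⟩
  -- the real part: `2L² Re⟨x,x⟩ + s Re⟨x, K x⟩ ≥ 0`
  have hexp : (star x ⬝ᵥ (((((2 * (L : ℝ) ^ 2 : ℝ) : ℂ) •
        (1 : Matrix (Finset (Orb (FermionTorus 2 L))) (Finset (Orb (FermionTorus 2 L))) ℂ) +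
      ((s : ℝ) : ℂ) • magneticKinOp L A)) *ᵥ x)).re =
      2 * (L : ℝ) ^ 2 * (star x ⬝ᵥ x).re + s * (star x ⬝ᵥ (magneticKinOp L A *ᵥ x)).re := by
    rw [add_mulVec, smul_mulVec, smul_mulVec, one_mulVec, dotProduct_add, dotProduct_smul, dotProduct_smul,
      smul_eq_mul, smul_eq_mul, Complex.add_re, Complex.re_ofReal_mul, Complex.re_ofReal_mul]
  rw [hexp]
  by_cases hx : x = 0
  · subst hx; simp
  obtain ⟨c, hc0, hc1⟩ := exists_smul_unit hx
  have hcc : star c * c = ((‖c‖ ^ 2 : ℝ) : ℂ) := by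
    rw [Complex.star_def, Complex.conj_mul', Complex.ofReal_pow]
  have hK : star (c • x) ⬝ᵥ (magneticKinOp L A *ᵥ (c • x)) =
      ((‖c‖ ^ 2 : ℝ) : ℂ) * (star x ⬝ᵥ (magneticKinOp L A *ᵥ x)) := by
    rw [star_smul, mulVec_smul, smul_dotProduct, dotProduct_smul, smul_smul, hcc, smul_eq_mul]
  have hnorm : ((‖c‖ ^ 2 : ℝ) : ℂ) * (star x ⬝ᵥ x) = 1 := by
    rw [← hc1, star_smul, smul_dotProduct, dotProduct_smul, smul_smul, hcc, smul_eq_mul]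
  have hnorm' : ‖c‖ ^ 2 * (star x ⬝ᵥ x).re = 1 := by
    have := congrArg Complex.re hnorm
    rwa [Complex.re_ofReal_mul, Complex.one_re] at this
  have hunit := abs_re_star_dotProduct_magneticKinOp_mulVec_le hL A hc1
  rw [hK, Complex.re_ofReal_mul] at hunit
  have hc2 : 0 < ‖c‖ ^ 2 := by positivity
  -- `|Re⟨x, K x⟩| ≤ 2L² Re⟨x,x⟩`
  have hbound : |(star x ⬝ᵥ (magneticKinOp L A *ᵥ x)).re| ≤ 2 * (L : ℝ) ^ 2 * (star x ⬝ᵥ x).re := by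
    have h1 : ‖c‖ ^ 2 * |(star x ⬝ᵥ (magneticKinOp L A *ᵥ x)).re| ≤ 2 * (L : ℝ) ^ 2 := by
      rwa [abs_mul, abs_of_pos hc2] at hunit
    have h2 : ‖c‖ ^ 2 * |(star x ⬝ᵥ (magneticKinOp L A *ᵥ x)).re| ≤
        ‖c‖ ^ 2 * (2 * (L : ℝ) ^ 2 * (star x ⬝ᵥ x).re) := by
      calc ‖c‖ ^ 2 * |(star x ⬝ᵥ (magneticKinOp L A *ᵥ x)).re| ≤ 2 * (L : ℝ) ^ 2 := h1
        _ = 2 * (L : ℝ) ^ 2 * (‖c‖ ^ 2 * (star x ⬝ᵥ x).re) := by rw [hnorm', mul_one]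
        _ = ‖c‖ ^ 2 * (2 * (L : ℝ) ^ 2 * (star x ⬝ᵥ x).re) := by ring
    exact le_of_mul_le_mul_left h2 hc2
  have hs' : |s * (star x ⬝ᵥ (magneticKinOp L A *ᵥ x)).re| ≤ 2 * (L : ℝ) ^ 2 * (star x ⬝ᵥ x).re := by
    rw [abs_mul]
    calc |s| * |(star x ⬝ᵥ (magneticKinOp L A *ᵥ x)).re|
        ≤ 1 * |(star x ⬝ᵥ (magneticKinOp L A *ᵥ x)).re| := by gcongr
      _ ≤ 2 * (L : ℝ) ^ 2 * (star x ⬝ᵥ x).re := by rw [one_mul]; exact hbound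
  have := neg_abs_le (s * (star x ⬝ᵥ (magneticKinOp L A *ᵥ x)).re)
  linarith

/-- **`|Re⟨K^A|_p⟩_{β,B}| ≤ 2L²`** for `L ≥ 2`, every gauge field `A`, every coordinate sector `p` and the Gibbs state of
ANY Hermitian block Hamiltonian `B` (positivity of the Gibbs state on `2L²·1 ± K^A`, compressed to the sector).
[cite: Watanabe2019, §4.1] -/
theorem abs_re_gibbsState_magneticKinOp_le (hL : 2 ≤ L) (A : GaugeConfig 2 L Circle) (β : ℝ)
    (p : Finset (Orb (FermionTorus 2 L)) → Prop) [Fintype {a // p a}] [DecidableEq {a // p a}]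
    {B : Matrix {a // p a} {a // p a} ℂ} (hB : B.IsHermitian) :
    |(gibbsState β B ((magneticKinOp L A).toBlock p p)).re| ≤ 2 * (L : ℝ) ^ 2 := by
  rcases isEmpty_or_nonempty {a // p a} with hp | hp
  · have h0 : gibbsState β B ((magneticKinOp L A).toBlock p p) = 0 := by
      simp [gibbsState_apply, Matrix.trace]
    rw [h0, Complex.zero_re, abs_zero]
    positivity
  have hone : gibbsState β B 1 = 1 := gibbsState_one β B (partitionFn_pos β hB).ne'
  have key : ∀ s : ℝ, |s| ≤ 1 →
      0 ≤ 2 * (L : ℝ) ^ 2 + s * (gibbsState β B ((magneticKinOp L A).toBlock p p)).re := by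
    intro s hs
    have hpsd := posSemidef_smul_one_add_smul_magneticKinOp hL A hs
    have h1 : 0 ≤ gibbsState β B
        (((((2 * (L : ℝ) ^ 2 : ℝ) : ℂ) •
            (1 : Matrix (Finset (Orb (FermionTorus 2 L))) (Finset (Orb (FermionTorus 2 L))) ℂ) +
          ((s : ℝ) : ℂ) • magneticKinOp L A)).toBlock p p) :=
      gibbsState_nonneg_of_posSemidef β hB (hpsd.submatrix Subtype.val)
    have hsplit : ((((2 * (L : ℝ) ^ 2 : ℝ) : ℂ) •
            (1 : Matrix (Finset (Orb (FermionTorus 2 L))) (Finset (Orb (FermionTorus 2 L))) ℂ) +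
          ((s : ℝ) : ℂ) • magneticKinOp L A)).toBlock p p =
        (((2 * (L : ℝ) ^ 2 : ℝ) : ℂ)) • (1 : Matrix {a // p a} {a // p a} ℂ) +
          ((s : ℝ) : ℂ) • (magneticKinOp L A).toBlock p p := by
      ext a b
      simp only [toBlock_apply, Matrix.add_apply, Matrix.smul_apply, smul_eq_mul, Matrix.one_apply,
        Subtype.ext_iff]
    rw [hsplit, map_add, map_smul, map_smul, hone, smul_eq_mul, mul_one, smul_eq_mul] at h1
    obtain ⟨hre, -⟩ := Complex.nonneg_iff.mp h1
    rw [Complex.add_re, Complex.ofReal_re, Complex.re_ofReal_mul] at hre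
    exact hre
  have hp1 := key 1 (by norm_num)
  have hm1 := key (-1) (by norm_num)
  rw [abs_le]
  constructor <;> linarith

/-- `log Z_p` at zero extra flux is the sector log-partition function of `H_A` itself (Watanabe's `U_0 = 1`).
[cite: Watanabe2019, §2.2.1] -/
theorem magneticTwistLogZ_zero (A : GaugeConfig 2 L Circle) (U β : ℝ) (p : Finset (Orb (FermionTorus 2 L)) → Prop)
    [Fintype {a // p a}] [DecidableEq {a // p a}] :
    magneticTwistLogZ L A U β 0 p = Real.log (partitionFn β ((magneticHubbardTorus L A 1 U).toBlock p p)).re := by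
  rw [magneticTwistLogZ, uniformTwistConfig_zero, mul_one]

/-- **The symmetrised thermal twist costs at most `2βθ²`** (`L ≥ 2`, `β ≥ 0`; every `A`, `U`, coordinate sector `p`):
`2 log Z_p(0) − 2βθ² ≤ log Z_p(θ) + log Z_p(−θ)` — the `T > 0` twin of Bloch's bound `E_A(θ) + E_A(−θ) ≤ 2E_A(0) + 2θ²`
(`magneticTwistEnergy_add_neg_le_of_two_le`). [cite: Bohm1949] [cite: ParamekantiTrivediRanderia1998, §IV] -/
theorem magneticTwistLogZ_add_neg_ge (hL : 2 ≤ L) (A : GaugeConfig 2 L Circle) (U θ : ℝ) {β : ℝ} (hβ : 0 ≤ β)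
    (p : Finset (Orb (FermionTorus 2 L)) → Prop) [Fintype {a // p a}] [DecidableEq {a // p a}] :
    2 * magneticTwistLogZ L A U β 0 p - 2 * β * θ ^ 2 ≤
      magneticTwistLogZ L A U β θ p + magneticTwistLogZ L A U β (-θ) p := by
  rw [magneticTwistLogZ_zero]
  unfold magneticTwistLogZ
  have h := log_partitionFn_toBlock_magneticTwist_add_neg_ge A U θ β p
  have hK := abs_re_gibbsState_magneticKinOp_le hL A β p
    ((magneticHubbardTorus_isHermitian A 1 U).submatrix (Subtype.val : {a // p a} → _))
  set g := (gibbsState β ((magneticHubbardTorus L A 1 U).toBlock p p) ((magneticKinOp L A).toBlock p p)).re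
    with hg
  have hL0 : (0 : ℝ) < L := Nat.cast_pos.2 (NeZero.pos L)
  have hc : 0 ≤ 1 - Real.cos (θ / L) := sub_nonneg.2 (Real.cos_le_one _)
  have hcos : 2 * (1 - Real.cos (θ / L)) ≤ (θ / L) ^ 2 := by
    have h := Real.one_sub_sq_div_two_le_cos (x := θ / L)
    nlinarith
  have hgle : g ≤ 2 * (L : ℝ) ^ 2 := (le_abs_self g).trans hK
  -- `2β(1 − cos(θ/L))·g ≤ 2β(1 − cos(θ/L))·2L² ≤ 2βθ²`
  have hstep1 : 2 * β * (1 - Real.cos (θ / L)) * g ≤ 2 * β * (1 - Real.cos (θ / L)) * (2 * (L : ℝ) ^ 2) := by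
    have : 0 ≤ 2 * β * (1 - Real.cos (θ / L)) := by positivity
    exact mul_le_mul_of_nonneg_left hgle this
  have hstep2 : 2 * β * (1 - Real.cos (θ / L)) * (2 * (L : ℝ) ^ 2) ≤ 2 * β * θ ^ 2 := by
    calc 2 * β * (1 - Real.cos (θ / L)) * (2 * (L : ℝ) ^ 2)
        = 2 * β * (2 * (1 - Real.cos (θ / L))) * (L : ℝ) ^ 2 := by ring
      _ ≤ 2 * β * (θ / L) ^ 2 * (L : ℝ) ^ 2 := by gcongr
      _ = 2 * β * θ ^ 2 := by field_simp
  linarith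

/-- **Every THERMAL flux stiffness of the Hubbard torus in an orbital field is at most `1`** (tree units, `t = 1`,
`k_B = 1`; `L ≥ 2`, `β > 0`): if `ρ` (any real) and `θ₀ > 0` satisfy the free-energy flux-stiffness inequality
`β ρ θ² ≤ log Z_p(0) − log Z_p(θ)` (`= β(F_p(θ) − F_p(0))`) for all `|θ| ≤ θ₀`, then `ρ ≤ 1` — for EVERY lattice `U(1)` gauge
field `A` (orbital magnetic field of any flux pattern), every coupling `U`, every coordinate sector `p` (hence every
filling, and — the Zeeman term being a constant on a fixed-`(N↑,N↓)` block — every uniform Zeeman field) and every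
temperature. The positive-temperature twin of `magneticFluxStiffness_le_one`; with the Nelson–Kosterlitz dictionary of
the cell (a hypothesis there, not here) it reads `k_BT_KT ≤ (π/4)·t` per plane at every orbital field WITHOUT any
`T = 0 → T_KT⁻` transfer. [cite: ScalapinoWhiteZhang1993, §II] [cite: ParamekantiTrivediRanderia1998, eq. (3) and §IV] -/
theorem magneticThermalFluxStiffness_le_one (hL : 2 ≤ L) (A : GaugeConfig 2 L Circle) (U : ℝ)
    (p : Finset (Orb (FermionTorus 2 L)) → Prop) [Fintype {a // p a}] [DecidableEq {a // p a}]
    {β ρ θ₀ : ℝ} (hβ : 0 < β) (hθ₀ : 0 < θ₀)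
    (hst : ∀ θ : ℝ, |θ| ≤ θ₀ →
      β * ρ * θ ^ 2 ≤ magneticTwistLogZ L A U β 0 p - magneticTwistLogZ L A U β θ p) :
    ρ ≤ 1 := by
  have hp := hst θ₀ (by rw [abs_of_pos hθ₀])
  have hm := hst (-θ₀) (by rw [abs_neg, abs_of_pos hθ₀])
  have hb := magneticTwistLogZ_add_neg_ge hL A U θ₀ hβ.le p
  have hsq : 0 < β * θ₀ ^ 2 := by positivity
  rw [neg_sq] at hm
  nlinarith

end Torus

end Literature.MathematicalPhysics.QuantumLattice

end
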